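import Mathlib
import Summits.ValiantsHypothesis.ValiantsHypothesis.Theorems.ProofCarryingSymmetryRestorationQPACLayoutSem

/-!
# Route ProofCarryingSymmetry — crux `RestorationQP`, line `registered`: which node sits where in the layout

B-core″, part 3d (the interface read by the necessity argument for T′).  For the straight-line
layout `layoutBody D f P` (part 3b) of a labelled circuit `D` under an injective numbering `f`
bounded by `P`, we record, index by index, the node found at each position of the block of a gate
`g` (`getD_layoutBody_block`): the output node `outPos f g` holds the leaf of an input gate
(`getD_layoutBody_outPos_of_var`, `getD_layoutBody_outPos_of_const`), the product `t × 1` for a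
fan-in-one gate (`getD_layoutBody_outPos_of_one`, with the unit leaf at `bl - 2`,
`getD_layoutBody_unit_of_one`), and for fan-in `r ≥ 2` the left comb over the children outputs
occupies the slots `bl + 1 - r, …, bl - 1` (`getD_layoutBody_comb_first_add`,
`getD_layoutBody_comb_succ_add`, `getD_layoutBody_comb_first_mul`, `getD_layoutBody_comb_succ_mul`),
the last of which is the output node (`outPos_eq_comb_last`).  Children outputs are earlier
(`kidPos_getD_lt`; the `k`-th one is `getD_kidPos` of part 3c) and renaming acts nodewise on a
body (`getD_map_node_rename`).

Registered helper: `invarianceProvableQP_aux_layoutNodes`.  Everything proved; no named facts.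
-/

-- single-problem summit: `Summit.ValiantsHypothesis.ValiantsHypothesis.…` is the namespace by design (D-0017)
set_option linter.dupNamespace false

noncomputable section

open scoped Classical

namespace Summit.ValiantsHypothesis.ValiantsHypothesis.Theorems

namespace ACStability

open Literature.Computability.AlgebraicComplexity PICircuit

universe u v

variable {𝔽 : Type u} [Zero 𝔽] [One 𝔽] {X : Type v}
variable {Yo : Type*} {G : Type*} [Fintype G] {D : LabelledArithCircuit 𝔽 X Yo G} {f : G → ℕ}

/-! ### Indices of the layout -/

/-- The layout has `P` blocks of length `bl`. [folklore] -/
theorem length_layoutBody (P : ℕ) : (layoutBody D f P).length = P * bl (G := G) := by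
  simp [layoutBody]

omit [Zero 𝔽] [One 𝔽] in
/-- An in-block index of a gate numbered below `P` lies inside the layout. [folklore] -/
theorem block_index_lt {P : ℕ} (hP : ∀ g, f g < P) (g : G) {j : ℕ} (hj : j < bl (G := G)) :
    f g * bl (G := G) + j < P * bl (G := G) :=
  calc f g * bl (G := G) + j < (f g + 1) * bl (G := G) := by rw [Nat.add_mul, one_mul]; omega
    _ ≤ P * bl (G := G) := Nat.mul_le_mul_right _ (hP g)

omit [Zero 𝔽] [One 𝔽] in
/-- The output node of the block of `g` is its last node, at in-block index `bl - 1`. [folklore] -/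
theorem outPos_eq (g : G) : outPos f g = f g * bl (G := G) + (bl (G := G) - 1) := rfl

omit [Zero 𝔽] [One 𝔽] in
/-- The output node of a block of fan-in `r ≥ 1` is the last comb slot `bl + (r - 1) - r`.
[folklore] -/
theorem outPos_eq_comb_last (g : G) {r : ℕ} (h1 : 1 ≤ r) (hr : r ≤ Fintype.card G) :
    outPos f g = f g * bl (G := G) + (bl (G := G) + (r - 1) - r) := by
  have hrb : r < bl (G := G) := Nat.lt_of_le_of_lt hr (Nat.lt_add_of_pos_right Nat.two_pos)
  unfold outPos
  omega

/-! ### Nodes of the layout, block by block -/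

/-- Node `j` of the block of `g` is `blockNode D f g j`. [folklore] -/
theorem getD_layoutBody_block (hf : Function.Injective f) {P : ℕ} (hP : ∀ g, f g < P) (g : G) {j : ℕ}
    (hj : j < bl (G := G)) :
    (layoutBody D f P).getD (f g * bl (G := G) + j) (.const 0) = blockNode D f g j := by
  rw [getD_layoutBody (block_index_lt hP g hj), nodeAt_block hf g hj]

/-- The output node of the block of a variable gate is the variable leaf. [folklore] -/
theorem getD_layoutBody_outPos_of_var (hf : Function.Injective f) {P : ℕ} (hP : ∀ g, f g < P) {g : G}
    {x : X} (hl : D.label g = .var x) : (layoutBody D f P).getD (outPos f g) (.const 0) = .var x := by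
  have hb := two_le_bl (G := G)
  rw [outPos_eq, getD_layoutBody_block hf hP g (by omega)]
  unfold blockNode
  simp only [hl]
  exact if_pos trivial

/-- The output node of the block of a constant gate is the constant leaf. [folklore] -/
theorem getD_layoutBody_outPos_of_const (hf : Function.Injective f) {P : ℕ} (hP : ∀ g, f g < P) {g : G}
    {c : 𝔽} (hl : D.label g = .const c) : (layoutBody D f P).getD (outPos f g) (.const 0) = .const c := by
  have hb := two_le_bl (G := G)
  rw [outPos_eq, getD_layoutBody_block hf hP g (by omega)]
  unfold blockNode
  simp only [hl]
  exact if_pos trivial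

/-- The block of an internal gate consists of comb nodes. [folklore] -/
theorem exists_blockNode_eq_combNode {g : G} (hg : ¬ (D.label g).IsInput) (j : ℕ) :
    ∃ mk : ℕ → ℕ → Node 𝔽 X, blockNode D f g j = combNode D f mk g j := by
  unfold blockNode
  rcases hl : D.label g with x | c | _ | _
  · exact absurd (by rw [hl]; exact CircuitLabel.isInput_var x) hg
  · exact absurd (by rw [hl]; exact CircuitLabel.isInput_const c) hg
  · exact ⟨.add, rfl⟩
  · exact ⟨.mul, rfl⟩

/-- The output node of the block of a fan-in-one internal gate is `t × 1`: the output of the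
child times the unit leaf at in-block index `bl - 2`. [folklore] -/
theorem getD_layoutBody_outPos_of_one (hf : Function.Injective f) {P : ℕ} (hP : ∀ g, f g < P) {g : G}
    (hg : ¬ (D.label g).IsInput) (h1 : (D.children g).toList.length = 1) :
    (layoutBody D f P).getD (outPos f g) (.const 0) =
      .mul ((kidPos D f g).getD 0 0) (f g * bl (G := G) + (bl (G := G) - 2)) := by
  have hb := two_le_bl (G := G)
  obtain ⟨mk, hmk⟩ := exists_blockNode_eq_combNode (f := f) hg (bl (G := G) - 1)
  rw [outPos_eq, getD_layoutBody_block hf hP g (by omega), hmk, combNode,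
    if_pos ((length_kidPos g).trans h1), if_pos rfl]

/-- The unit leaf `1` of the block of a fan-in-one internal gate, at in-block index `bl - 2`.
[folklore] -/
theorem getD_layoutBody_unit_of_one (hf : Function.Injective f) {P : ℕ} (hP : ∀ g, f g < P) {g : G}
    (hg : ¬ (D.label g).IsInput) (h1 : (D.children g).toList.length = 1) :
    (layoutBody D f P).getD (f g * bl (G := G) + (bl (G := G) - 2)) (.const 0) = .const 1 := by
  have hb := two_le_bl (G := G)
  obtain ⟨mk, hmk⟩ := exists_blockNode_eq_combNode (f := f) hg (bl (G := G) - 2)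
  rw [getD_layoutBody_block hf hP g (by omega), hmk, combNode, if_pos ((length_kidPos g).trans h1),
    if_neg (by omega), if_pos rfl]

/-- **The first comb node** (node constructor `mk`) of the block of an internal gate of fan-in
`r ≥ 2`, at in-block index `bl + 1 - r`: it combines the outputs of the first two children.
[folklore] -/
theorem combNode_first (mk : ℕ → ℕ → Node 𝔽 X) {g : G} (h2 : 2 ≤ (D.children g).toList.length) :
    combNode D f mk g (bl (G := G) + 1 - (D.children g).toList.length) =
      mk ((kidPos D f g).getD 0 0) ((kidPos D f g).getD 1 0) := by
  have hbl : bl (G := G) = Fintype.card G + 2 := rfl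
  have hrG := length_toList_children_le (D := D) g
  rw [combNode, length_kidPos g, if_neg (by omega), if_pos (by omega), if_pos (by omega)]

/-- **The later comb nodes** (node constructor `mk`) of the block of an internal gate of fan-in
`r ≥ 2`: for `2 ≤ k < r`, the node at in-block index `bl + k - r` combines the previous node
with the output of child `k`. [folklore] -/
theorem combNode_succ (mk : ℕ → ℕ → Node 𝔽 X) {g : G} {k : ℕ} (hk : 2 ≤ k)
    (hkr : k < (D.children g).toList.length) :
    combNode D f mk g (bl (G := G) + k - (D.children g).toList.length) =
      mk (f g * bl (G := G) + (bl (G := G) + k - (D.children g).toList.length) - 1)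
        ((kidPos D f g).getD k 0) := by
  have hbl : bl (G := G) = Fintype.card G + 2 := rfl
  have hrG := length_toList_children_le (D := D) g
  rw [combNode, length_kidPos g, if_neg (by omega), if_pos (by omega), if_neg (by omega),
    show bl (G := G) + k - (D.children g).toList.length + (D.children g).toList.length - bl (G := G) = k by
      omega]

/-- The first comb node of the block of a `+` gate of fan-in `r ≥ 2` (in-block index
`bl + 1 - r`) adds the outputs of the first two children. [folklore] -/
theorem getD_layoutBody_comb_first_add (hf : Function.Injective f) {P : ℕ} (hP : ∀ g, f g < P) {g : G}
    (hl : D.label g = .add) (h2 : 2 ≤ (D.children g).toList.length) :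
    (layoutBody D f P).getD (f g * bl (G := G) + (bl (G := G) + 1 - (D.children g).toList.length)) (.const 0) =
      .add ((kidPos D f g).getD 0 0) ((kidPos D f g).getD 1 0) := by
  have hb := two_le_bl (G := G)
  rw [getD_layoutBody_block hf hP g (by omega), ← combNode_first .add h2]
  unfold blockNode
  simp only [hl]

/-- The `k`-th comb node (`2 ≤ k < r`) of the block of a `+` gate of fan-in `r` (in-block index
`bl + k - r`) adds the previous comb node and the output of child `k`. [folklore] -/
theorem getD_layoutBody_comb_succ_add (hf : Function.Injective f) {P : ℕ} (hP : ∀ g, f g < P) {g : G}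
    (hl : D.label g = .add) {k : ℕ} (hk : 2 ≤ k) (hkr : k < (D.children g).toList.length) :
    (layoutBody D f P).getD (f g * bl (G := G) + (bl (G := G) + k - (D.children g).toList.length)) (.const 0) =
      .add (f g * bl (G := G) + (bl (G := G) + k - (D.children g).toList.length) - 1)
        ((kidPos D f g).getD k 0) := by
  have hb := two_le_bl (G := G)
  rw [getD_layoutBody_block hf hP g (by omega), ← combNode_succ .add hk hkr]
  unfold blockNode
  simp only [hl]

/-- The first comb node of the block of a `×` gate of fan-in `r ≥ 2` (in-block index
`bl + 1 - r`) multiplies the outputs of the first two children. [folklore] -/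
theorem getD_layoutBody_comb_first_mul (hf : Function.Injective f) {P : ℕ} (hP : ∀ g, f g < P) {g : G}
    (hl : D.label g = .mul) (h2 : 2 ≤ (D.children g).toList.length) :
    (layoutBody D f P).getD (f g * bl (G := G) + (bl (G := G) + 1 - (D.children g).toList.length)) (.const 0) =
      .mul ((kidPos D f g).getD 0 0) ((kidPos D f g).getD 1 0) := by
  have hb := two_le_bl (G := G)
  rw [getD_layoutBody_block hf hP g (by omega), ← combNode_first .mul h2]
  unfold blockNode
  simp only [hl]

/-- The `k`-th comb node (`2 ≤ k < r`) of the block of a `×` gate of fan-in `r` (in-block index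
`bl + k - r`) multiplies the previous comb node by the output of child `k`. [folklore] -/
theorem getD_layoutBody_comb_succ_mul (hf : Function.Injective f) {P : ℕ} (hP : ∀ g, f g < P) {g : G}
    (hl : D.label g = .mul) {k : ℕ} (hk : 2 ≤ k) (hkr : k < (D.children g).toList.length) :
    (layoutBody D f P).getD (f g * bl (G := G) + (bl (G := G) + k - (D.children g).toList.length)) (.const 0) =
      .mul (f g * bl (G := G) + (bl (G := G) + k - (D.children g).toList.length) - 1)
        ((kidPos D f g).getD k 0) := by
  have hb := two_le_bl (G := G)
  rw [getD_layoutBody_block hf hP g (by omega), ← combNode_succ .mul hk hkr]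
  unfold blockNode
  simp only [hl]

/-! ### Children positions and renaming -/

omit [Zero 𝔽] [One 𝔽] in
/-- Children outputs come before the block of the parent. [folklore] -/
theorem kidPos_getD_lt (hmono : ∀ g h : G, h ∈ D.children g → f h < f g) (g : G) {k : ℕ}
    (hk : k < (D.children g).toList.length) : (kidPos D f g).getD k 0 < f g * bl (G := G) := by
  rw [getD_kidPos g hk]
  exact outPos_lt_of_lt (hmono g _ (Finset.mem_toList.1 (List.getElem_mem hk)))

omit [One 𝔽] in
/-- Renaming a body renames it node by node (the default junk leaf `0` is fixed). [folklore] -/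
theorem getD_map_node_rename {X' : Type*} (l : List (Node 𝔽 X)) (ρ : X → X') (i : ℕ) :
    (l.map (Node.rename ρ)).getD i (.const 0) = (l.getD i (.const 0)).rename ρ :=
  List.getD_map l (Node.const 0) (Node.rename ρ)

end ACStability

open Literature.Computability.AlgebraicComplexity in
/-- **Node `j` of the block of a gate `g` in the straight-line layout of a labelled circuit is
`blockNode D f g j`** (registered helper toward the necessity of stub T′ `stub_invarianceProvableQP'`,
crux `RestorationQP`: the interface read by the gate-by-gate `P_c` simulation of an automorphism of
a symmetric circuit). [folklore] -/
theorem invarianceProvableQP_aux_layoutNodes : ∀ (n : ℕ) (G : Type) [Fintype G] (D : LabelledArithCircuit ℂ (Fin n × Fin n) Unit G) (f : G → ℕ) (P : ℕ), Function.Injective f → (∀ g : G, f g < P) → ∀ (g : G) (j : ℕ), j < ACStability.bl (G := G) → (ACStability.layoutBody D f P).getD (f g * ACStability.bl (G := G) + j) (PICircuit.Node.const 0 : PICircuit.Node ℂ (Fin n × Fin n)) = ACStability.blockNode D f g j := by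
  intro n G _ D f P hf hP g j hj
  exact ACStability.getD_layoutBody_block hf hP g hj

end Summit.ValiantsHypothesis.ValiantsHypothesis.Theorems

end
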